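import Summits.BirchSwinnertonDyer.Rank1Residual.AdditivePotMult.RankOneHeegnerClass
import HarnessLib

/-!
# X4 (in particular X4(M)) under big image: in BOTH analytic ranks `BSD(E,p)` follows from LOWER
# halves alone (Kim 2026 in rank `0`, Kolyvagin + Gross–Zagier over a Heegner field in rank `1`)

HONEST FRAMING (cell `b2b-bsdres`, run/shared/lean/b2b/bsd-rank1-residual/, verbatim in every
file): the goal of the cell is to DELETE the COMBINATION-SHAPED residual classes of the
Birch–Swinnerton-Dyer formula for ALL analytic-rank `≤ 1` elliptic curves over `ℚ` — "full BSD
formula for every rank `≤ 1` curve in class `C`" assembled STRICTLY from published theorems — so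
that the rank-`≤ 1` remainder becomes exactly the CONSTRUCTION-SHAPED classes, which are TYPED
(missing-input `Prop`s), NOT attempted. This is not "finishing BSD". Sub-cell
`b2b-bsdres-additive-p1` (CLASS-OWNERS row "X3/X4 additive — pot. multiplicative / X3♯(M)"),
generation 4; research route, no claim beyond the stated sub-classes; X4(M) REMAINS
CONSTRUCTION-SHAPED; nothing is booked.

Theorems only; no definition, no new named fact. The capstone of `OneSided.lean` (gen 2: in rank `0`
the UPPER half of `BSD(E,p)` at an additive prime is Kim 2026 Thm. 1.8 (6), via additive-p4's
`X4RankZero.bsdp_of_missingLowerBoundAt`) and `RankOneHeegner{,Class}.lean` (gen 4: in rank `1` the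
UPPER half is Kolyvagin's, relative to the LOWER halves of the rank-zero Heegner twists, which are
X4(M) pairs with the same `j`):

* `classX4_twist_of_heegner` — the rank-zero Heegner twist of an X4 pair is an X4 pair with the
  same `j` (class X4 — additive, irreducible, `p` odd — transports along a `p`-adic-square twist;
  so do its sub-cells X4(M) = X4 ∧ `ord_p j < 0` and X4♯(G-ord), read off `j`).
* **`bsdp_of_classX4_of_lowerHalves`** — for `(E,p) ∈ X4` (`W` globally minimal; ANY additive type:
  potentially multiplicative, potentially good ordinary or supersingular) of analytic rank `≤ 1` with
  `p ≥ 5`, `ρ̄_{E,p}` onto, a parametrisation datum `D` at level `N_E` with `p ∤ c(D)` and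
  `p ∤ ∏_ℓ c_ℓ(E)`: IF every X4 pair `(V,p)` with `j(V) = j(E)` and analytic rank `≤ 1` satisfies the
  LOWER half `MissingLowerBoundAt V p` (`ord_p #Ш(V)_an ≤ ord_p #Ш(V)`, the Skinner–Urban /
  Eisenstein-congruence direction), THEN `BSD(E,p)`. Published binders only: Kim 2026 (`hKim`),
  Gross–Zagier (`hGZ`), Kolyvagin (`hKo`, `hB`), GZK (`hGZK`), modularity (`hmod`, `hnf`),
  Friedberg–Hoffstein (`hFH`). `bsdp_of_classX4_of_ram_of_lowerHalves`: `Ram W p` in place of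
  surjectivity (`surj_of_irr_of_ram`, any reduction at `p`).
* `bsdp_of_classX4M_of_lowerHalves` — the X4(M) reading (hypothesis over the same-`j` X4(M) pairs),
  and `lowerHalves_of_jWitness_of_lowerOverC` — that hypothesis from the over-`K'` lower halves on
  the (`j`-witness) branch.

So on X4 ∩ {`p ≥ 5`, ρ̄ onto (e.g. (ram) on `E`), Manin-unit datum, `p ∤ ∏c_ℓ`} the cell's missing
input is, in both ranks, EXACTLY of lower-bound type over `ℚ` — on X4(M) ∧ (`j`-witness)
equivalently (gens 2–4: the halves-iff `missingLowerBoundAt_iff_overC`) the lower half of the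
`p`-part of BSD over one quadratic field ramified at `p`; on X4♯(G-ord) (additive-p2) likewise over
`ℚ(√p*)`. Census sizes for the surjective / Manin
rows are instrument data and are not claimed here. Labels UNCHANGED; nothing booked.
-/

noncomputable section

open scoped Classical NumberField

open WeierstrassCurve NumberField Literature.NumberTheory.EllipticCurves
  Literature.NumberTheory.EllipticCurves.ModularForms
  Literature.NumberTheory.EllipticCurves.Rank1Residual
  Literature.NumberTheory.EllipticCurves.Rank1Residual.Typed
  Literature.NumberTheory.Automorphic
  IsDedekindDomain

namespace Summit.BirchSwinnertonDyer.Rank1Residual.AdditivePotMult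

variable {W : WeierstrassCurve ℚ} [W.IsElliptic] {p : ℕ} [Fact p.Prime]

/-- **The rank-zero Heegner twist of an X4 pair is an X4 pair with the same `j`-invariant** (class
X4 = `p` odd ∧ additive ∧ irreducible transports along the twist by a Heegner field `K` for `N_E`,
in which the bad prime `p` splits, `d_K ∈ ℚ_p^{×2}`: `addv_iff_of_twist`, x11b's
`hasIrreducibleModPGaloisRep_twist_model`; `j` is a twist invariant). [folklore] -/
theorem classX4_twist_of_heegner (hX : ClassX4 W p)
    (K : Type) [Field K] [NumberField K] (hK : IsImaginaryQuadratic K)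
    (hHN : SatisfiesHeegnerHypothesis (W.conductorNorm ℤ) K)
    (Wd : WeierstrassCurve ℚ) [Wd.IsElliptic]
    (hWd : ∃ C : VariableChange ℚ, C • W.quadraticTwist (NumberField.discr K : ℚ) = Wd) :
    ClassX4 Wd p ∧ Wd.j = W.j := by
  have hD0 : (NumberField.discr K : ℚ) ≠ 0 := by exact_mod_cast NumberField.discr_ne_zero K
  have hpN : p ∣ W.conductorNorm ℤ :=
    (W.dvd_conductorNorm_iff_not_hasGoodReductionAtPrime p).mpr hX.2.1.1
  have hsq' : IsSquare (algebraMap ℚ ℚ_[p] (NumberField.discr K : ℚ)) :=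
    X11b.isSquare_discr_padic_of_heegner K hK hHN p hpN
  have hsq : IsSquare (((NumberField.discr K : ℚ) : ℚ) : ℚ_[p]) := by simpa using hsq'
  obtain ⟨C, hC⟩ := hWd
  exact ⟨⟨hX.1, (addv_iff_of_twist hD0 hsq Wd hC).mpr hX.2.1,
    X11b.hasIrreducibleModPGaloisRep_twist_model W p K hK.1 hX.2.2 C hC⟩, j_of_model_twist hD0 ⟨C, hC⟩⟩

/-- **X4, big image, either rank: `BSD(E,p)` from LOWER halves alone.** For `(E,p) ∈ X4` (`W`
globally minimal; any additive type) with `ord_{s=1} L(E,s) ≤ 1`, `p ≥ 5`, `ρ̄_{E,p}` onto, a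
parametrisation datum `D` at level `N_E` with `p ∤ c(D)`, and `p ∤ ∏_ℓ c_ℓ(E)`: if every X4 pair
`(V,p)` with `j(V) = j(E)` and analytic rank `≤ 1` satisfies `MissingLowerBoundAt V p`, then
`BSDp W p`. Rank `0`: Kim 2026 Thm. 1.8 (6) gives the upper half (additive-p4's
`X4RankZero.bsdp_of_missingLowerBoundAt`), the lower half is the hypothesis at `V = W`. Rank `1`:
Kolyvagin + Gross–Zagier over a Friedberg–Hoffstein Heegner field
(`bsdp_of_bad_rankOne_of_lower_of_lowerTwists`), the rank-zero Heegner twists being X4 pairs with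
the same `j` (`classX4_twist_of_heegner`) whose lower halves are the hypothesis. X4 stays
CONSTRUCTION-SHAPED. [cite: Kim2022StructureSelmer, Thm. 1.8 (6)]
[cite: McCallumLMS1991, §1 Theorem (Kolyvagin), p. 296] [cite: Miller2011LMS, Def. 1.1] -/
theorem bsdp_of_classX4_of_lowerHalves [W.IsGloballyMinimal]
    (hKim : Kim2026.rankZero_padicValNat_sha_le_of_maninConstant)
    (hGZ : ∀ (N : ℕ) [NeZero N] (W : WeierstrassCurve ℚ) (K : Type) [Field K] [NumberField K],
      gross_zagier N W K)
    (hKo : ∀ (N : ℕ) [NeZero N] (W : WeierstrassCurve ℚ) (K : Type) [Field K] [NumberField K],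
      kolyvagin N W K)
    (hB : ∀ (N : ℕ) [NeZero N] (W : WeierstrassCurve ℚ) (K : Type) [Field K] [NumberField K],
      Kolyvagin1990_padicValNat_card_sha_le N W K)
    (hGZK : rank_eq_analyticRank_of_analyticRank_le_one) (hmod : hasEntireLFunction_rat)
    (hnf : exists_isNewformOf) (hFH : friedbergHoffstein_exists_heegnerField_split_twist_ne_zero)
    [NeZero (W.conductorNorm ℤ)]
    (hX : ClassX4 W p) (hr : W.analyticRank ≤ 1) (hsurj : Surj W p) (hp5 : 5 ≤ p)
    (D : ModularParametrizationData W (W.conductorNorm ℤ)) (hc : ¬ (p : ℤ) ∣ D.c)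
    (htam : ¬ p ∣ W.tamagawaProduct)
    (hlow : ∀ (V : WeierstrassCurve ℚ) [V.IsElliptic] [V.IsGloballyMinimal], ClassX4 V p →
      V.j = W.j → V.analyticRank ≤ 1 → MissingLowerBoundAt V p) :
    BSDp W p := by
  rcases Nat.le_one_iff_eq_zero_or_eq_one.mp hr with hr0 | hr1
  · exact Additive.X4RankZero.bsdp_of_missingLowerBoundAt W p hKim hGZK hmod hp5 hr0 hX hsurj D hc
      htam (hlow W hX rfl hr)
  · exact bsdp_of_bad_rankOne_of_lower_of_lowerTwists hGZ hKo hB hGZK hmod hnf hFH W p hX.2.1.1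
      hX.2.2 hsurj hp5 hr1 D hc htam (hlow W hX rfl hr) fun K _ _ Wd _ _ hK hHN hWd hrd ↦ by
        obtain ⟨hXd, hj⟩ := classX4_twist_of_heegner hX K hK hHN Wd hWd
        exact hlow Wd hXd hj (by rw [hrd]; exact zero_le_one)

/-- **The same on X4 ∧ (ram)** — surjectivity from `Irr ∧ Ram` (`surj_of_irr_of_ram`, Serre 1972
Prop. 15 with the Tate curve at the (ram) prime; ANY reduction at `p`). [folklore] -/
theorem bsdp_of_classX4_of_ram_of_lowerHalves [W.IsGloballyMinimal]
    (hKim : Kim2026.rankZero_padicValNat_sha_le_of_maninConstant)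
    (hGZ : ∀ (N : ℕ) [NeZero N] (W : WeierstrassCurve ℚ) (K : Type) [Field K] [NumberField K],
      gross_zagier N W K)
    (hKo : ∀ (N : ℕ) [NeZero N] (W : WeierstrassCurve ℚ) (K : Type) [Field K] [NumberField K],
      kolyvagin N W K)
    (hB : ∀ (N : ℕ) [NeZero N] (W : WeierstrassCurve ℚ) (K : Type) [Field K] [NumberField K],
      Kolyvagin1990_padicValNat_card_sha_le N W K)
    (hGZK : rank_eq_analyticRank_of_analyticRank_le_one) (hmod : hasEntireLFunction_rat)
    (hnf : exists_isNewformOf) (hFH : friedbergHoffstein_exists_heegnerField_split_twist_ne_zero)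
    [NeZero (W.conductorNorm ℤ)]
    (hX : ClassX4 W p) (hr : W.analyticRank ≤ 1) (hram : Ram W p) (hp5 : 5 ≤ p)
    (D : ModularParametrizationData W (W.conductorNorm ℤ)) (hc : ¬ (p : ℤ) ∣ D.c)
    (htam : ¬ p ∣ W.tamagawaProduct)
    (hlow : ∀ (V : WeierstrassCurve ℚ) [V.IsElliptic] [V.IsGloballyMinimal], ClassX4 V p →
      V.j = W.j → V.analyticRank ≤ 1 → MissingLowerBoundAt V p) :
    BSDp W p :=
  bsdp_of_classX4_of_lowerHalves hKim hGZ hKo hB hGZK hmod hnf hFH hX hr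
    (surj_of_irr_of_ram W p hX.2.2 hram) hp5 D hc htam hlow

/-- **X4(M) reading**: for `(E,p) ∈ X4(M)` it suffices to assume the lower halves of the X4(M)
pairs with the same `j` (a same-`j` X4 pair of an X4(M) pair is X4(M): `ord_p j < 0` is read off
`j`). [folklore] -/
theorem bsdp_of_classX4M_of_lowerHalves [W.IsGloballyMinimal]
    (hKim : Kim2026.rankZero_padicValNat_sha_le_of_maninConstant)
    (hGZ : ∀ (N : ℕ) [NeZero N] (W : WeierstrassCurve ℚ) (K : Type) [Field K] [NumberField K],
      gross_zagier N W K)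
    (hKo : ∀ (N : ℕ) [NeZero N] (W : WeierstrassCurve ℚ) (K : Type) [Field K] [NumberField K],
      kolyvagin N W K)
    (hB : ∀ (N : ℕ) [NeZero N] (W : WeierstrassCurve ℚ) (K : Type) [Field K] [NumberField K],
      Kolyvagin1990_padicValNat_card_sha_le N W K)
    (hGZK : rank_eq_analyticRank_of_analyticRank_le_one) (hmod : hasEntireLFunction_rat)
    (hnf : exists_isNewformOf) (hFH : friedbergHoffstein_exists_heegnerField_split_twist_ne_zero)
    [NeZero (W.conductorNorm ℤ)]
    (hX : ClassX4M W p) (hr : W.analyticRank ≤ 1) (hsurj : Surj W p) (hp5 : 5 ≤ p)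
    (D : ModularParametrizationData W (W.conductorNorm ℤ)) (hc : ¬ (p : ℤ) ∣ D.c)
    (htam : ¬ p ∣ W.tamagawaProduct)
    (hlow : ∀ (V : WeierstrassCurve ℚ) [V.IsElliptic] [V.IsGloballyMinimal], ClassX4M V p →
      V.j = W.j → V.analyticRank ≤ 1 → MissingLowerBoundAt V p) :
    BSDp W p :=
  bsdp_of_classX4_of_lowerHalves hKim hGZ hKo hB hGZK hmod hnf hFH hX.1 hr hsurj hp5 D hc htam
    fun V _ _ hV hj hrV ↦ hlow V ⟨hV, hV.2.1, by rw [hj]; exact hX.potMult.2⟩ hj hrV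

/-- **X4(M) ∧ (ram) reading** (surjectivity from `surj_of_irr_of_ram`). [folklore] -/
theorem bsdp_of_classX4M_of_ram_of_lowerHalves [W.IsGloballyMinimal]
    (hKim : Kim2026.rankZero_padicValNat_sha_le_of_maninConstant)
    (hGZ : ∀ (N : ℕ) [NeZero N] (W : WeierstrassCurve ℚ) (K : Type) [Field K] [NumberField K],
      gross_zagier N W K)
    (hKo : ∀ (N : ℕ) [NeZero N] (W : WeierstrassCurve ℚ) (K : Type) [Field K] [NumberField K],
      kolyvagin N W K)
    (hB : ∀ (N : ℕ) [NeZero N] (W : WeierstrassCurve ℚ) (K : Type) [Field K] [NumberField K],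
      Kolyvagin1990_padicValNat_card_sha_le N W K)
    (hGZK : rank_eq_analyticRank_of_analyticRank_le_one) (hmod : hasEntireLFunction_rat)
    (hnf : exists_isNewformOf) (hFH : friedbergHoffstein_exists_heegnerField_split_twist_ne_zero)
    [NeZero (W.conductorNorm ℤ)]
    (hX : ClassX4M W p) (hr : W.analyticRank ≤ 1) (hram : Ram W p) (hp5 : 5 ≤ p)
    (D : ModularParametrizationData W (W.conductorNorm ℤ)) (hc : ¬ (p : ℤ) ∣ D.c)
    (htam : ¬ p ∣ W.tamagawaProduct)
    (hlow : ∀ (V : WeierstrassCurve ℚ) [V.IsElliptic] [V.IsGloballyMinimal], ClassX4M V p →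
      V.j = W.j → V.analyticRank ≤ 1 → MissingLowerBoundAt V p) :
    BSDp W p :=
  bsdp_of_classX4M_of_lowerHalves hKim hGZ hKo hB hGZK hmod hnf hFH hX hr
    (surj_of_irr_of_ram W p hX.irr hram) hp5 D hc htam hlow

/-- **The lower halves over `ℚ` FROM the over-`K'` lower halves, on the (`j`-witness) branch** — so
that `bsdp_of_classX4M_of_lowerHalves` can be fed in the sub-cell's over-`K'` currency: for every
X4(M) pair `(V,p)` of analytic rank `≤ 1` with a `j`-witness, `MissingLowerBoundAt V p` follows from
`MissingLowerBoundOverCAt (V.baseChange K') p` over the quadratic fields `K'` whose twist is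
`p`-multiplicative (`missingLowerBoundAt_of_classX4M_of_jWitness_of_lowerOverC`; Skinner 2016
Thm. C, Milne 1972, Hoffstein–Luo). Packaged for all same-`j` pairs at once (they share the
`j`-witness). [folklore] -/
theorem lowerHalves_of_jWitness_of_lowerOverC [W.IsGloballyMinimal]
    (hGZK : rank_eq_analyticRank_of_analyticRank_le_one) (hmod : hasEntireLFunction_rat)
    (hMilneC : Milne1972.bsdQuotient_baseChange_quadratic_anyModel)
    (hSk : Skinner2016.thmC_padicValRat_bsd_rank_zero)
    (hnf : exists_isNewformOf) (hHL : HoffsteinLuo1997_exists_twist_L_one_ne_zero)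
    {q : ℕ} (hq : q.Prime) (hqp : q ≠ p) (hjq : padicValRat q W.j < 0)
    (hpj : ¬ (p : ℤ) ∣ padicValRat q W.j)
    (hlowK : ∀ (V : WeierstrassCurve ℚ) [V.IsElliptic] [V.IsGloballyMinimal], ClassX4M V p →
      V.j = W.j → V.analyticRank ≤ 1 →
      ∀ (K : Type) [Field K] [NumberField K] (Vd : WeierstrassCurve ℚ) [Vd.IsElliptic]
        [Vd.IsGloballyMinimal], Module.finrank ℚ K = 2 →
        (∃ C : VariableChange ℚ, C • V.quadraticTwist (NumberField.discr K : ℚ) = Vd) →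
        Mult Vd p → MissingLowerBoundOverCAt (V.baseChange K) p) :
    ∀ (V : WeierstrassCurve ℚ) [V.IsElliptic] [V.IsGloballyMinimal], ClassX4M V p →
      V.j = W.j → V.analyticRank ≤ 1 → MissingLowerBoundAt V p := by
  intro V _ _ hV hj hrV
  have hjq' : padicValRat q V.j < 0 := by rw [hj]; exact hjq
  have hpj' : ¬ (p : ℤ) ∣ padicValRat q V.j := by rw [hj]; exact hpj
  exact missingLowerBoundAt_of_classX4M_of_jWitness_of_lowerOverC hGZK hmod hMilneC hSk hnf hHL hV hrV
    hq hqp hjq' hpj' (hlowK V hV hj hrV)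

end Summit.BirchSwinnertonDyer.Rank1Residual.AdditivePotMult

end
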